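import Summits.AnomalousDissipation.AnomalousDissipation.Theorems.SawtoothPulseCascadeK1LocalisedCascadeStripBlock
import Literature.Analysis.FunctionSpaces.TorusTrilinearH1

/-!
# K1loc, line `Spectral` / thin start — helper: L²-STABILITY OF A HALF-STEP UNDER A PROFILE PERTURBATION SMALL OFF A SMALL SET

Helper file of the prover lane on the crux `K1LocalisedCascade` (stmt-AnomalousDissipation-19491), route
`SawtoothPulseCascade` (S-B ↔ S-D glue for the START of the ledger).  The spectral ledger runs on the inviscid iterates of the
ROUNDED cascade (`δ_j = δ₀2^{−j} > 0`), while start profiles / certified start energies and exact-chirp computations are most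
easily obtained for the EXACT sawtooth (`δ = 0`), or for another `δ₀`.  Comparing the two cascades fibre by fibre
(`‖g_δ − g₀‖_∞ ≤ γ|n|δ₀√(2/π)`) degrades linearly in the frequency; the comparison below does not see the frequency at all:
a half-step `v ↦ v ∘ Ψ_c`, `Ψ_c(x) = x − c(x_j)e_i` (`c : T → T` measurable — the shear `shearMap i j P` of a smooth profile is the
case `c = P.onCircle mod 1`, `shearMap_apply`; the exact Lipschitz sawtooth is covered too), is compared with `v ↦ v ∘ Ψ_{c′}` at the
cost of the SUP NORM on the cylinder over the set `Z` where `c` and `c′` are far apart, plus a pointwise term off `Z`: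
* §1 `measurePreserving_sub_single_comp_eval` — `Ψ_c` preserves the volume of `T^d` for every measurable `c` (`i ≠ j`; skew
  translation in the coordinates `T^{d∖{i}} × T^{{i}}`), `integral_comp_sub_single_comp_eval` (change of variables),
  `volume_setOf_eval_mem` (`vol{x : x_j ∈ Z} = vol Z`);
* §2 **`integral_norm_sq_sub_shear_le`** — `‖v‖ ≤ B`, `vol Z ≤ m`, `‖v(Ψ_c x) − v(Ψ_{c′} x)‖ ≤ ε` for `x_j ∉ Z`
  ⇒ `∫‖v∘Ψ_c − v∘Ψ_{c′}‖² ≤ ε² + (2B)²m`; Lipschitz form `…_of_lipschitz` (`ε = Lη` for `v` `L`-Lipschitz along `e_i` and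
  `‖c − c′‖ ≤ η` off `Z`, `norm_sub_shear_le_of_lipschitz`); and the recursion step **`sqrt_integral_norm_sq_sub_shear_le`**:
  `‖v∘Ψ_c − w∘Ψ_{c′}‖_{L²} ≤ √(ε² + (2B)²m) + ‖v − w‖_{L²}` (Minkowski + §1), so that over `n` phases (two half-steps each) the two
  cascades started from the same datum differ in `L²` by at most `Σ_halfsteps √(ε_s² + 4m_s)` (`B = 1`); for the rounded vs exact
  sawtooth `Z` = corner layers of width `Mδ_j` around the `2N_j` corners (`m = 4N_jMδ_j`), `ε ≍ ‖∂_iv‖_∞·γ·e^{−M²/2}/N_j`;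
* `norm_coe_sub_coe_le` — `‖a mod 1 − b mod 1‖ ≤ |a − b|` (to feed real profile bounds into `‖c − c′‖ ≤ η`).
No definitions; no statement about the crux. [cite: Grafakos2014, Prop. 3.1.2 (5)] [cite: DEIJ2022, (1.2)–(1.3) (alternating shears)]
[problem: turb]
-/

-- `Summit.<Summit>.<Problem>`: single-conjunct summit, the duplicate namespace segment is deliberate.
set_option linter.dupNamespace false

noncomputable section

namespace Summit.AnomalousDissipation.AnomalousDissipation.Theorems.SawtoothPulseCascade.K1Start

open MeasureTheory Set Filter Topology UnitAddTorus Function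
open Literature.Analysis.FunctionSpaces Literature.Analysis.FunctionSpaces.Torus

variable {d : Type*} [Fintype d] [DecidableEq d]

/-! ## §1 Skew shears by a measurable circle map preserve the volume; coordinate cylinders -/

/-- **A skew shear `x ↦ x − c(x_j)·e_i` (`i ≠ j`, `c` measurable) preserves the volume of `T^d`** — the shear map
`shearMap i j P` of a smooth profile is the case `c = P.onCircle (mod 1)`, but the exact (Lipschitz) sawtooth shear is covered
too.  In the coordinates `T^d ≃ T^{d∖{i}} × T^{{i}}` it is a translation of the second factor by an amount depending on the first.
[folklore] -/
theorem measurePreserving_sub_single_comp_eval {i j : d} (hij : i ≠ j) {c : UnitAddCircle → UnitAddCircle}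
    (hc : Measurable c) :
    MeasurePreserving (fun x : UnitAddTorus d => x - Pi.single i (c (x j))) volume volume := by
  classical
  have hji : j ≠ i := fun h => hij h.symm
  have he := volume_preserving_piEquivPiSubtypeProd (fun _ : d => UnitAddCircle) (fun l => l ≠ i)
  set e := MeasurableEquiv.piEquivPiSubtypeProd (fun _ : d => UnitAddCircle) (fun l => l ≠ i) with he_def
  set v : ({l : d // l ≠ i} → UnitAddCircle) → ({l : d // ¬ l ≠ i} → UnitAddCircle) :=
    fun b _ => c (b ⟨j, hji⟩) with hv_def
  have hvm : Measurable v := measurable_pi_lambda _ fun _ => hc.comp (measurable_pi_apply _)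
  have hΨ : MeasurePreserving
      (fun z : ({l : d // l ≠ i} → UnitAddCircle) × ({l : d // ¬ l ≠ i} → UnitAddCircle) => (z.1, z.2 - v z.1))
      ((volume : Measure ({l : d // l ≠ i} → UnitAddCircle)).prod (volume : Measure ({l : d // ¬ l ≠ i} → UnitAddCircle)))
      ((volume : Measure ({l : d // l ≠ i} → UnitAddCircle)).prod (volume : Measure ({l : d // ¬ l ≠ i} → UnitAddCircle))) := by
    refine (MeasurePreserving.id volume).skew_product (g := fun b a => a - v b)
      (measurable_snd.sub (hvm.comp measurable_fst)) (Eventually.of_forall fun b => ?_)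
    exact (measurePreserving_sub_right volume (v b)).map_eq
  have hinter : (fun x : UnitAddTorus d => x - Pi.single i (c (x j))) =
      e.symm ∘ (fun z : ({l : d // l ≠ i} → UnitAddCircle) × ({l : d // ¬ l ≠ i} → UnitAddCircle) =>
        (z.1, z.2 - v z.1)) ∘ e := by
    funext x
    ext l
    simp only [Function.comp_apply, he_def, MeasurableEquiv.piEquivPiSubtypeProd_symm_apply,
      MeasurableEquiv.piEquivPiSubtypeProd_apply]
    by_cases hl : l = i
    · subst hl
      simp [hv_def]
    · simp [hl]
  rw [hinter]
  exact he.symm.comp (hΨ.comp he)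

/-- **Change of variables** for the skew shear: `∫ f(x − c(x_j)e_i) dx = ∫ f`. [folklore] -/
theorem integral_comp_sub_single_comp_eval {E : Type*} [NormedAddCommGroup E] [NormedSpace ℝ E] {i j : d} (hij : i ≠ j)
    {c : UnitAddCircle → UnitAddCircle} (hc : Measurable c) (f : UnitAddTorus d → E) :
    ∫ x : UnitAddTorus d, f (x - Pi.single i (c (x j))) = ∫ x, f x := by
  have h := measurePreserving_sub_single_comp_eval (d := d) hij hc
  have hji : j ≠ i := fun h => hij h.symm
  have hcj : Measurable fun x : UnitAddTorus d => c (x j) := hc.comp (measurable_pi_apply j)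
  have hsc : Measurable fun x : UnitAddTorus d => (Pi.single i (c (x j)) : UnitAddTorus d) :=
    (continuous_single i).measurable.comp hcj
  have hinv : Measurable fun x : UnitAddTorus d => x + Pi.single i (c (x j)) := measurable_id.add hsc
  have hfix : ∀ (x : UnitAddTorus d) (s : UnitAddCircle), (x - Pi.single i s : UnitAddTorus d) j = x j := fun x s => by
    rw [Pi.sub_apply, Pi.single_eq_of_ne hji, sub_zero]
  have hfix' : ∀ (x : UnitAddTorus d) (s : UnitAddCircle), (x + Pi.single i s : UnitAddTorus d) j = x j := fun x s => by
    rw [Pi.add_apply, Pi.single_eq_of_ne hji, add_zero]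
  -- the skew shear is a measurable equivalence (its inverse is the shear by `-c`)
  let Φe : UnitAddTorus d ≃ UnitAddTorus d :=
    { toFun := fun x : UnitAddTorus d => x - Pi.single i (c (x j))
      invFun := fun x : UnitAddTorus d => x + Pi.single i (c (x j))
      left_inv := fun x => by
        change x - Pi.single i (c (x j)) + Pi.single i (c ((x - Pi.single i (c (x j)) : UnitAddTorus d) j)) = x
        rw [hfix, sub_add_cancel]
      right_inv := fun x => by
        change x + Pi.single i (c (x j)) - Pi.single i (c ((x + Pi.single i (c (x j)) : UnitAddTorus d) j)) = x
        rw [hfix', add_sub_cancel_right] }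
  let Φ : UnitAddTorus d ≃ᵐ UnitAddTorus d :=
    { toEquiv := Φe
      measurable_toFun := h.measurable
      measurable_invFun := hinv }
  have hΦ' : MeasurePreserving Φ volume volume := h
  exact hΦ'.integral_comp' f

omit [DecidableEq d] in
/-- **Coordinate cylinders**: `vol {x ∈ T^d : x_j ∈ Z} = vol Z`. [folklore] -/
theorem volume_setOf_eval_mem (j : d) {Z : Set UnitAddCircle} (hZ : MeasurableSet Z) :
    volume {x : UnitAddTorus d | x j ∈ Z} = volume Z := by
  haveI : IsProbabilityMeasure (volume : Measure UnitAddCircle) := ⟨UnitAddCircle.measure_univ⟩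
  have hev : MeasurePreserving (fun x : UnitAddTorus d => x j) volume volume :=
    measurePreserving_eval (fun _ : d => (volume : Measure UnitAddCircle)) j
  rw [← hev.measure_preimage hZ.nullMeasurableSet]
  rfl

/-! ## §2 One half-step: stability under a profile perturbation that is small off a small set -/

omit [Fintype d] in
/-- **Pointwise**: if `v` is `L`-Lipschitz along `e_i` (`‖v(y − s·e_i) − v(y)‖ ≤ L‖s‖`), then
`‖v(x − c(x_j)e_i) − v(x − c′(x_j)e_i)‖ ≤ L·‖c(x_j) − c′(x_j)‖`. [folklore] -/
theorem norm_sub_shear_le_of_lipschitz {V : Type*} [NormedAddCommGroup V] {v : UnitAddTorus d → V} (i j : d) {L : ℝ}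
    (hLip : ∀ (y : UnitAddTorus d) (s : UnitAddCircle), ‖v (y - Pi.single i s) - v y‖ ≤ L * ‖s‖)
    (c c' : UnitAddCircle → UnitAddCircle) (x : UnitAddTorus d) :
    ‖v (x - Pi.single i (c (x j))) - v (x - Pi.single i (c' (x j)))‖ ≤ L * ‖c (x j) - c' (x j)‖ := by
  have key : x - Pi.single i (c (x j)) = (x - Pi.single i (c' (x j))) - Pi.single i (c (x j) - c' (x j)) := by
    rw [Pi.single_sub, sub_sub, add_sub_cancel]
  rw [key]
  exact hLip _ _

/-- **L²-STABILITY OF A HALF-STEP** (frequency-independent form).  `v` continuous on `T^d` with `‖v‖ ≤ B`; two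
measurable circle maps `c, c′` and a measurable set `Z ⊆ T` of measure `≤ m` OFF which the two sheared copies of `v` are
`ε`-close pointwise (`‖v(x − c(x_j)e_i) − v(x − c′(x_j)e_i)‖ ≤ ε` whenever `x_j ∉ Z`; e.g. `ε = L·η` for `v` `L`-Lipschitz along
`e_i` and `‖c − c′‖ ≤ η` off `Z`, `norm_sub_shear_le_of_lipschitz`; or `ε = 0` if `c = c′` off `Z`).  Then
`∫ ‖v(x − c(x_j)e_i) − v(x − c′(x_j)e_i)‖² dx ≤ ε² + (2B)²·m` — the perturbation is paid by the sup norm on the cylinder over `Z`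
only (for the rounded vs exact sawtooth: `Z` = the corner layers, `m ≍ N_j M δ_j`, `ε ≍ ‖∂_i v‖_∞ e^{−M²/2}/N_j`). [folklore] -/
theorem integral_norm_sq_sub_shear_le {v : UnitAddTorus d → ℂ} (hv : Continuous v) {B ε m : ℝ} (hB : ∀ y, ‖v y‖ ≤ B)
    (i j : d) {c c' : UnitAddCircle → UnitAddCircle} (hc : Measurable c) (hc' : Measurable c') {Z : Set UnitAddCircle}
    (hZ : MeasurableSet Z) (hm : volume.real Z ≤ m)
    (hoff : ∀ x : UnitAddTorus d, x j ∉ Z → ‖v (x - Pi.single i (c (x j))) - v (x - Pi.single i (c' (x j)))‖ ≤ ε) :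
    ∫ x : UnitAddTorus d, ‖v (x - Pi.single i (c (x j))) - v (x - Pi.single i (c' (x j)))‖ ^ 2 ≤
      ε ^ 2 + (2 * B) ^ 2 * m := by
  haveI : IsProbabilityMeasure (volume : Measure UnitAddCircle) := ⟨UnitAddCircle.measure_univ⟩
  have hB0 : 0 ≤ B := (norm_nonneg _).trans (hB 0)
  set C : Set (UnitAddTorus d) := {x | x j ∈ Z} with hC
  have hCm : MeasurableSet C := hZ.preimage (measurable_pi_apply j)
  -- pointwise majorant `ε² + (2B)²·1_C`
  set g : UnitAddTorus d → ℝ := fun x => ε ^ 2 + (2 * B) ^ 2 * C.indicator (fun _ => (1 : ℝ)) x with hg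
  have h2B : ∀ x : UnitAddTorus d, ‖v (x - Pi.single i (c (x j))) - v (x - Pi.single i (c' (x j)))‖ ≤ 2 * B :=
    fun x => (norm_sub_le _ _).trans (by linarith [hB (x - Pi.single i (c (x j))), hB (x - Pi.single i (c' (x j)))])
  have hpt : ∀ x, ‖v (x - Pi.single i (c (x j))) - v (x - Pi.single i (c' (x j)))‖ ^ 2 ≤ g x := by
    intro x
    by_cases hx : x j ∈ Z
    · have hxC : x ∈ C := hx
      simp only [hg, indicator_of_mem hxC, mul_one]
      have h3 := pow_le_pow_left₀ (norm_nonneg _) (h2B x) 2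
      nlinarith [sq_nonneg ε]
    · have hxC : x ∉ C := hx
      simp only [hg, indicator_of_notMem hxC, mul_zero, add_zero]
      exact pow_le_pow_left₀ (norm_nonneg _) (hoff x hx) 2
  -- integrability
  have hmeas : ∀ {e : UnitAddCircle → UnitAddCircle}, Measurable e →
      Measurable fun x : UnitAddTorus d => x - Pi.single i (e (x j)) := by
    intro e he
    have hej : Measurable fun x : UnitAddTorus d => e (x j) := he.comp (measurable_pi_apply j)
    exact measurable_id.sub ((continuous_single i).measurable.comp hej)
  have hFm : AEStronglyMeasurable (fun x : UnitAddTorus d =>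
      ‖v (x - Pi.single i (c (x j))) - v (x - Pi.single i (c' (x j)))‖ ^ 2) volume :=
    (((hv.measurable.comp (hmeas hc)).sub (hv.measurable.comp (hmeas hc'))).norm.pow_const 2).aestronglyMeasurable
  have hF : Integrable (fun x : UnitAddTorus d =>
      ‖v (x - Pi.single i (c (x j))) - v (x - Pi.single i (c' (x j)))‖ ^ 2) := by
    refine Integrable.of_bound hFm ((2 * B) ^ 2) (Eventually.of_forall fun x => ?_)
    rw [Real.norm_eq_abs, abs_of_nonneg (by positivity)]
    exact pow_le_pow_left₀ (norm_nonneg _) (h2B x) 2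
  have hInd : Integrable (C.indicator fun _ : UnitAddTorus d => (1 : ℝ)) :=
    (integrable_const (1 : ℝ)).indicator hCm
  have hG : Integrable g := (integrable_const _).add (hInd.const_mul _)
  have hCvol : volume.real C = volume.real Z := by
    simp only [measureReal_def, hC, volume_setOf_eval_mem j hZ]
  have hIg : ∫ x, g x = ε ^ 2 + (2 * B) ^ 2 * volume.real Z := by
    simp only [hg]
    rw [integral_add (integrable_const _) (hInd.const_mul _), integral_const, integral_const_mul,
      integral_indicator_const (1 : ℝ) hCm, smul_eq_mul, smul_eq_mul, probReal_univ, one_mul, mul_one, hCvol]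
  have hmono : ∫ x : UnitAddTorus d, ‖v (x - Pi.single i (c (x j))) - v (x - Pi.single i (c' (x j)))‖ ^ 2 ≤ ∫ x, g x :=
    MeasureTheory.integral_mono hF hG fun x => hpt x
  have hlast : (2 * B) ^ 2 * volume.real Z ≤ (2 * B) ^ 2 * m := mul_le_mul_of_nonneg_left hm (sq_nonneg _)
  linarith

/-- **Lipschitz form**: for `v` `L`-Lipschitz along `e_i` and `‖c − c′‖ ≤ η` off `Z`,
`∫ ‖v(x − c(x_j)e_i) − v(x − c′(x_j)e_i)‖² ≤ (Lη)² + (2B)²·m`. [folklore] -/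
theorem integral_norm_sq_sub_shear_le_of_lipschitz {v : UnitAddTorus d → ℂ} (hv : Continuous v) {B L η m : ℝ}
    (hB : ∀ y, ‖v y‖ ≤ B) (i j : d)
    (hLip : ∀ (y : UnitAddTorus d) (s : UnitAddCircle), ‖v (y - Pi.single i s) - v y‖ ≤ L * ‖s‖) (hL : 0 ≤ L)
    {c c' : UnitAddCircle → UnitAddCircle} (hc : Measurable c) (hc' : Measurable c') {Z : Set UnitAddCircle}
    (hZ : MeasurableSet Z) (hm : volume.real Z ≤ m) (hclose : ∀ t, t ∉ Z → ‖c t - c' t‖ ≤ η) :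
    ∫ x : UnitAddTorus d, ‖v (x - Pi.single i (c (x j))) - v (x - Pi.single i (c' (x j)))‖ ^ 2 ≤
      (L * η) ^ 2 + (2 * B) ^ 2 * m :=
  integral_norm_sq_sub_shear_le hv hB i j hc hc' hZ hm fun x hx =>
    (norm_sub_shear_le_of_lipschitz i j hLip c c' x).trans (mul_le_mul_of_nonneg_left (hclose _ hx) hL)

/-- **L²-stability of a half-step, two inputs** (the recursion step of the comparison of two cascades with nearby profiles):
under the hypotheses of `integral_norm_sq_sub_shear_le` with `c, c′` continuous, for any second continuous input `w`,
`‖v∘Ψ_c − w∘Ψ_{c′}‖_{L²} ≤ √(ε² + (2B)²m) + ‖v − w‖_{L²}` (Minkowski, and `Ψ_{c′}` preserves the volume). [folklore] -/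
theorem sqrt_integral_norm_sq_sub_shear_le {v w : UnitAddTorus d → ℂ} (hv : Continuous v) (hw : Continuous w)
    {B ε m : ℝ} (hB : ∀ y, ‖v y‖ ≤ B) {i j : d} (hij : i ≠ j)
    {c c' : UnitAddCircle → UnitAddCircle} (hc : Continuous c) (hc' : Continuous c') {Z : Set UnitAddCircle}
    (hZ : MeasurableSet Z) (hm : volume.real Z ≤ m)
    (hoff : ∀ x : UnitAddTorus d, x j ∉ Z → ‖v (x - Pi.single i (c (x j))) - v (x - Pi.single i (c' (x j)))‖ ≤ ε) :
    Real.sqrt (∫ x : UnitAddTorus d, ‖v (x - Pi.single i (c (x j))) - w (x - Pi.single i (c' (x j)))‖ ^ 2) ≤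
      Real.sqrt (ε ^ 2 + (2 * B) ^ 2 * m) + Real.sqrt (∫ x : UnitAddTorus d, ‖v x - w x‖ ^ 2) := by
  have hshear : ∀ {e : UnitAddCircle → UnitAddCircle}, Continuous e →
      Continuous fun x : UnitAddTorus d => x - Pi.single i (e (x j)) := fun he =>
    continuous_id.sub ((continuous_single i).comp (he.comp (continuous_apply j)))
  set f₁ : UnitAddTorus d → ℂ := fun x => v (x - Pi.single i (c (x j))) - v (x - Pi.single i (c' (x j))) with hf₁
  set f₂ : UnitAddTorus d → ℂ := fun x => v (x - Pi.single i (c' (x j))) - w (x - Pi.single i (c' (x j))) with hf₂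
  have hf₁c : Continuous f₁ := (hv.comp (hshear hc)).sub (hv.comp (hshear hc'))
  have hf₂c : Continuous f₂ := (hv.comp (hshear hc')).sub (hw.comp (hshear hc'))
  have hsum : ∀ x, v (x - Pi.single i (c (x j))) - w (x - Pi.single i (c' (x j))) = f₁ x + f₂ x := by
    intro x; simp only [hf₁, hf₂]; ring
  simp_rw [hsum]
  refine (sqrt_integral_norm_add_sq_le hf₁c hf₂c).trans (add_le_add ?_ ?_)
  · exact Real.sqrt_le_sqrt (integral_norm_sq_sub_shear_le hv hB i j hc.measurable hc'.measurable hZ hm hoff)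
  · have h := integral_comp_sub_single_comp_eval (d := d) hij hc'.measurable (fun y => ‖v y - w y‖ ^ 2)
    exact (congrArg Real.sqrt h).le

omit [Fintype d] [DecidableEq d] in
/-- Distances on `ℝ/ℤ` are at most distances of representatives: `‖a mod 1 − b mod 1‖ ≤ |a − b|`
(for the hypothesis `‖c − c′‖ ≤ η`: two real profiles `γU`, `γU′` with `|U − U′| ≤ η/γ` off the layers). [folklore] -/
theorem norm_coe_sub_coe_le (a b : ℝ) : ‖((a : UnitAddCircle) - (b : UnitAddCircle) : UnitAddCircle)‖ ≤ |a - b| := by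
  rw [← AddCircle.coe_sub]
  exact (QuotientAddGroup.norm_mk_le_norm (S := AddSubgroup.zmultiples (1 : ℝ)) (m := a - b)).trans_eq
    (Real.norm_eq_abs _)

end Summit.AnomalousDissipation.AnomalousDissipation.Theorems.SawtoothPulseCascade.K1Start
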